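import Mathlib
import Summits.Ventures.PercRepro.PuncturedLYMMixP1Q5Table1

/-!
# PercRepro — (SP) FOR `1` PAIRWISE DISJOINT PAIRS AND `5` PAIRWISE DISJOINT QUADRUPLES AT LEVEL `4`: POSITIVITY OF THE DENOMINATORS (1)
(p10, gen 41)

`den > 0`, `Pc > 0` for `n ≥ 22`; `Yc > 0` for `n ≥ 5`.  Nothing here asserts (SP).
-/

namespace PercRepro.PuncturedLYM.Split.TypeLift.MixP1Q5

/-- `den > 0` for `n ≥ 22`. -/
theorem den_pos (n : ℚ) (hn : 22 ≤ n) : 0 < den n := by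
  obtain ⟨n', hn', rfl⟩ : ∃ n', 0 ≤ n' ∧ n = 22 + n' := ⟨n - 22, by linarith, by ring⟩
  have h : den (22 + n') = 55296 * n' ^ 12 + 13662720 * n' ^ 11 + 1545892224 * n' ^ 10 + 105915033696 * n' ^ 9 + 4893980881488 * n' ^ 8 + 160667533388688 * n' ^ 7 + 3842773750314240 * n' ^ 6 + 67466982793333056 * n' ^ 5 + 862951365740950416 * n' ^ 4 + 7842201739091563728 * n' ^ 3 + 48062810595916990368 * n' ^ 2 + 178364172429409167360 * n' + 303105212975822929920 := by unfold den; ring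
  rw [h]; positivity

/-- `Yc > 0` for `n ≥ 5`. -/
theorem Yc_pos (n : ℚ) (hn : 5 ≤ n) : 0 < Yc n := by
  obtain ⟨n', hn', rfl⟩ : ∃ n', 0 ≤ n' ∧ n = 5 + n' := ⟨n - 5, by linarith, by ring⟩
  have h : Yc (5 + n') = (1 / 120) * n' ^ 5 + (1 / 8) * n' ^ 4 + (17 / 24) * n' ^ 3 + (15 / 8) * n' ^ 2 + (137 / 60) * n' + 1 := by unfold Yc; ring
  rw [h]; positivity

/-- `Pc > 0` for `n ≥ 22`. -/
theorem Pc_pos (n : ℚ) (hn : 22 ≤ n) : 0 < Pc n := by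
  obtain ⟨n', hn', rfl⟩ : ∃ n', 0 ≤ n' ∧ n = 22 + n' := ⟨n - 22, by linarith, by ring⟩
  have h : Pc (22 + n') = (1 / 24) * n' ^ 4 + (41 / 12) * n' ^ 3 + (2507 / 24) * n' ^ 2 + (16945 / 12) * n' + 7120 := by unfold Pc; ring
  rw [h]; positivity

end PercRepro.PuncturedLYM.Split.TypeLift.MixP1Q5
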